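import Summits.ABC.ABC.Theses.IneffectiveSubspace

/-!
# Framing facts for crux `IneffectiveSubspace.TowerFourSubLiouville` (stmt-ABC-1649): the `ABC`-sandwich, coprimality, and the shape of a bad point

Negative-side support, companion of `Negative/DialCalibration.lean` (cdisprove seat
refuter-cdisprove-stmt-ABC-1649-0, 2026-08-16).  Three facts that frame every attack on the crux
`∃ A < 2, TowerIneq(4, A)`:

* `towerFourSubLiouville_of_abc : ABC → TowerFourSubLiouville` (through `towerIneq4_one_of_abc`,
  `ABC ⟹ TowerIneq(4, 1)`, the level-4 case of the route's support item `AbcGivesTower`): the crux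
  cannot be refuted short of refuting `ABC`; the ingredients are `rad(abc) ∣ ∏ xᵢyᵢzᵢ`
  (`rad_dvd_towerProd`) and monotonicity of `Real.rpow`.
* `towerIneq4NoCoprime_of_abc : ABC → ∀ A > 5/3, TowerIneq(4, A)` WITHOUT the coprimality
  hypothesis (`cube_lt_of_abc`: `g = gcd(a,b)`, `c = g·c'`, `g³c'² ≤ 2abc ≤ 2Π⁴`,
  `c' < K·rad(a'b'c')^{1+e} ≤ K·Π^{1+e}`, so `c³ < 2K·Π^{5+e}`).  With
  `towerIneq4NoCoprime_false_below_four_thirds` (DialCalibration): under `ABC` the non-coprime dial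
  lies in `[4/3, 5/3]` while the coprime dial is `1`; the crux's threshold `2` sits above both, so
  coprimality is not what a proof of the crux has to exploit.
* `bad_point_shape` (unconditional; from the exact identity `towerProd_pow_four_eq : Π⁴ = abc·E`,
  `E = (x₀y₀z₀)³(x₁y₁z₁)²(x₂y₂z₂)`): a positive point with `C·Π^s ≤ c` has
  `min(a,b)·E·c² ≤ 2(c/C)^{4/s}`; for `s = 2 − δ` this says `min(a,b)·E ≤ 2C^{-4/s} c^{2δ/(2−δ)}`, i.e.
  every bad point is a coprime solution of a diagonal quartic Thue equation `wZ⁴ − vY⁴ = a` with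
  `a·v·w ≤ c^{O(δ)}` — the regime where only per-form (Thue–Siegel–Roth, Faltings) and counting
  (Bombieri–Schmidt, Evertse, Bennett) results exist, none bounding the SIZE of solutions uniformly.
-/

namespace Summit.ABC.ABC.Theorems.TowerFourSubLiouville.Negative

open scoped BigOperators
open Summit.ABC.ABC.Theses.IneffectiveSubspace
open Literature.NumberTheory.DiophantineGeometry (IsABCTriple rad rad_def)

/-- `rad(abc)` divides `∏ xᵢyᵢzᵢ` for a tower point (`abc = ∏ (xᵢyᵢzᵢ)^{i+1}`; `radical_prod_dvd`,
`radical_pow_dvd`, `radical_dvd_self`). -/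
theorem rad_dvd_towerProd (x y z : Fin 4 → ℕ) :
    Literature.NumberTheory.DiophantineGeometry.rad (∏ i, x i ^ (i.val + 1)) (∏ i, y i ^ (i.val + 1))
      (∏ i, z i ^ (i.val + 1)) ∣ ∏ i, x i * y i * z i := by
  rw [Literature.NumberTheory.DiophantineGeometry.rad_def]
  have hprod : (∏ i, x i ^ (i.val + 1)) * (∏ i, y i ^ (i.val + 1)) * (∏ i, z i ^ (i.val + 1)) =
      ∏ i, (x i * y i * z i) ^ (i.val + 1) := by
    rw [← Finset.prod_mul_distrib, ← Finset.prod_mul_distrib]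
    refine Finset.prod_congr rfl fun i _ => ?_
    ring
  rw [hprod]
  calc UniqueFactorizationMonoid.radical (∏ i, (x i * y i * z i) ^ (i.val + 1))
      ∣ ∏ i, UniqueFactorizationMonoid.radical ((x i * y i * z i) ^ (i.val + 1)) :=
        UniqueFactorizationMonoid.radical_prod_dvd
    _ ∣ ∏ i, (x i * y i * z i) := Finset.prod_dvd_prod_of_dvd _ _ fun i _ =>
        UniqueFactorizationMonoid.radical_pow_dvd.trans UniqueFactorizationMonoid.radical_dvd_self

/-- **The sandwich.** `ABC ⟹ TowerIneq4 1`, hence `ABC ⟹` the crux (take `A = 1 < 2`): a tower point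
gives the abc triple `(a,b,c)` and `rad(abc) ≤ ∏ xᵢyᵢzᵢ`.  (Level-4 instance of the route's support
item `AbcGivesTower`, stmt-ABC-1652.)  Consequently any refutation of the crux refutes `ABC`. -/
theorem towerIneq4_one_of_abc (habc : ABC) :
    ∀ ε : ℝ, 0 < ε → ∃ C : ℝ, 0 < C ∧ ∀ x y z : Fin 4 → ℕ, (∀ i, 0 < x i ∧ 0 < y i ∧ 0 < z i) →
      (∏ i, x i ^ (i.val + 1)) + (∏ i, y i ^ (i.val + 1)) = ∏ i, z i ^ (i.val + 1) →
      Nat.Coprime (∏ i, x i ^ (i.val + 1)) (∏ i, y i ^ (i.val + 1)) →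
      ((∏ i, z i ^ (i.val + 1) : ℕ) : ℝ) < C * ((∏ i, x i * y i * z i : ℕ) : ℝ) ^ (1 + ε) := by
  intro ε hε
  obtain ⟨C, hC, h⟩ := (ABC_iff.mp habc) ε hε
  refine ⟨C, hC, fun x y z hpos heq hcop => ?_⟩
  have ha : 0 < ∏ i, x i ^ (i.val + 1) := Finset.prod_pos fun i _ => pow_pos (hpos i).1 _
  have hb : 0 < ∏ i, y i ^ (i.val + 1) := Finset.prod_pos fun i _ => pow_pos (hpos i).2.1 _
  have hlt := h _ _ _ ⟨ha, hb, heq, hcop⟩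
  have hPpos : 0 < ∏ i, x i * y i * z i :=
    Finset.prod_pos fun i _ => Nat.mul_pos (Nat.mul_pos (hpos i).1 (hpos i).2.1) (hpos i).2.2
  have hle : ((Literature.NumberTheory.DiophantineGeometry.rad (∏ i, x i ^ (i.val + 1))
      (∏ i, y i ^ (i.val + 1)) (∏ i, z i ^ (i.val + 1)) : ℕ) : ℝ) ≤ ((∏ i, x i * y i * z i : ℕ) : ℝ) := by
    exact_mod_cast Nat.le_of_dvd hPpos (rad_dvd_towerProd x y z)
  calc ((∏ i, z i ^ (i.val + 1) : ℕ) : ℝ)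
      < C * ((Literature.NumberTheory.DiophantineGeometry.rad (∏ i, x i ^ (i.val + 1))
          (∏ i, y i ^ (i.val + 1)) (∏ i, z i ^ (i.val + 1)) : ℕ) : ℝ) ^ (1 + ε) := hlt
    _ ≤ C * ((∏ i, x i * y i * z i : ℕ) : ℝ) ^ (1 + ε) := by
        apply mul_le_mul_of_nonneg_left _ hC.le
        exact Real.rpow_le_rpow (by positivity) hle (by linarith)

/-- `ABC ⟹` the crux `IneffectiveSubspace.TowerFourSubLiouville` (`A = 1`): a refutation of the crux would
refute `ABC`. -/
theorem towerFourSubLiouville_of_abc (habc : ABC) : TowerFourSubLiouville :=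
  ⟨1, by norm_num, towerIneq4_one_of_abc habc⟩

/-- Core of "coprimality is not load-bearing": from abc with exponent `1 + e` one gets, for ANY
positive `a + b = c` (not necessarily coprime) and any `P` with `abc ≤ P⁴` and `rad(abc) ∣ P`,
the bound `c³ < 2K · P^{5+e}` — write `g = gcd(a,b)`, `c = g c'`: `g³c'² ≤ 2abc ≤ 2P⁴` and
`c' < K rad(a'b'c')^{1+e} ≤ K P^{1+e}`. -/
theorem cube_lt_of_abc {K e : ℝ} (he : 0 ≤ e)
    (hK' : ∀ a b c : ℕ, IsABCTriple a b c → (c : ℝ) < K * (rad a b c : ℝ) ^ (1 + e))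
    {a b c P : ℕ} (ha : 0 < a) (hb : 0 < b) (hc : a + b = c) (hP0 : 0 < P)
    (hP : a * b * c ≤ P ^ 4) (hrad : UniqueFactorizationMonoid.radical (a * b * c) ∣ P) :
    (c : ℝ) ^ 3 < 2 * K * (P : ℝ) ^ (5 + e) := by
  set g := Nat.gcd a b with hg
  have hg0 : 0 < g := Nat.gcd_pos_of_pos_left _ ha
  obtain ⟨a', ha'⟩ : ∃ a', a = g * a' := Nat.gcd_dvd_left a b
  obtain ⟨b', hb'⟩ : ∃ b', b = g * b' := Nat.gcd_dvd_right a b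
  have ha'0 : 0 < a' := by
    rcases Nat.eq_zero_or_pos a' with h0 | h0
    · rw [h0, mul_zero] at ha'; omega
    · exact h0
  have hb'0 : 0 < b' := by
    rcases Nat.eq_zero_or_pos b' with h0 | h0
    · rw [h0, mul_zero] at hb'; omega
    · exact h0
  have hcop : Nat.Coprime a' b' := by
    have h1 : a' = a / g := by rw [ha', Nat.mul_div_cancel_left _ hg0]
    have h2 : b' = b / g := by rw [hb', Nat.mul_div_cancel_left _ hg0]
    rw [h1, h2]; exact Nat.coprime_div_gcd_div_gcd hg0
  have hc' : c = g * (a' + b') := by rw [← hc, ha', hb']; ring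
  -- abc for the primitive triple
  have htriple : IsABCTriple a' b' (a' + b') := ⟨ha'0, hb'0, rfl, hcop⟩
  have hlt := hK' _ _ _ htriple
  -- rad(a'b'c') ∣ rad(abc) ∣ P
  have hc0 : 0 < c := hc ▸ Nat.add_pos_left ha b
  have habc0 : a * b * c ≠ 0 := (Nat.mul_pos (Nat.mul_pos ha hb) hc0).ne'
  have hdvd' : a' * b' * (a' + b') ∣ a * b * c :=
    mul_dvd_mul (mul_dvd_mul (Dvd.intro_left _ ha'.symm) (Dvd.intro_left _ hb'.symm))
      (Dvd.intro_left _ hc'.symm)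
  have hradle : (rad a' b' (a' + b') : ℝ) ≤ P := by
    have h1 : rad a' b' (a' + b') ∣ P := by
      rw [rad_def]
      exact (UniqueFactorizationMonoid.radical_dvd_radical hdvd' habc0).trans hrad
    exact_mod_cast Nat.le_of_dvd hP0 h1
  have hKpos : 0 < K := by
    -- from hlt at the triple: 0 < c' < K * rad^(1+e), rad^(1+e) > 0
    have hr : (0 : ℝ) < (rad a' b' (a' + b') : ℝ) ^ (1 + e) := by
      apply Real.rpow_pos_of_pos
      rw [rad_def]; exact_mod_cast Nat.radical_pos _
    have hcpos : (0 : ℝ) < ((a' + b' : ℕ) : ℝ) := by positivity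
    by_contra hK
    have hK0 : K ≤ 0 := not_lt.mp hK
    have : K * (rad a' b' (a' + b') : ℝ) ^ (1 + e) ≤ 0 := mul_nonpos_of_nonpos_of_nonneg hK0 hr.le
    linarith
  have hc'lt : ((a' + b' : ℕ) : ℝ) < K * (P : ℝ) ^ (1 + e) := by
    calc ((a' + b' : ℕ) : ℝ) < K * (rad a' b' (a' + b') : ℝ) ^ (1 + e) := hlt
      _ ≤ K * (P : ℝ) ^ (1 + e) := by
          apply mul_le_mul_of_nonneg_left _ hKpos.le
          exact Real.rpow_le_rpow (by positivity) hradle (by linarith)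
  -- g³ c'² ≤ 2 abc ≤ 2 P⁴  (in ℝ)
  have hineq : ((g : ℝ) ^ 3 * ((a' + b' : ℕ) : ℝ) ^ 2) ≤ 2 * (P : ℝ) ^ 4 := by
    have h1 : ((a' + b' : ℕ) : ℝ) ≤ 2 * (a' : ℝ) * b' := by
      have : (1 : ℝ) ≤ a' := by exact_mod_cast ha'0
      have : (1 : ℝ) ≤ b' := by exact_mod_cast hb'0
      push_cast; nlinarith
    have h2 : (a : ℝ) * b * c ≤ (P : ℝ) ^ 4 := by exact_mod_cast hP
    have h3 : (a : ℝ) * b * c = (g : ℝ) ^ 3 * ((a' : ℝ) * b' * ((a' + b' : ℕ) : ℝ)) := by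
      rw [ha', hb', hc']; push_cast; ring
    have hg' : (0 : ℝ) ≤ (g : ℝ) ^ 3 := by positivity
    have hcn : (0 : ℝ) ≤ ((a' + b' : ℕ) : ℝ) := by positivity
    calc (g : ℝ) ^ 3 * ((a' + b' : ℕ) : ℝ) ^ 2 = (g : ℝ) ^ 3 * (((a' + b' : ℕ) : ℝ) * ((a' + b' : ℕ) : ℝ)) := by ring
      _ ≤ (g : ℝ) ^ 3 * ((2 * (a' : ℝ) * b') * ((a' + b' : ℕ) : ℝ)) := by
          apply mul_le_mul_of_nonneg_left _ hg'
          exact mul_le_mul_of_nonneg_right h1 hcn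
      _ = 2 * ((a : ℝ) * b * c) := by rw [h3]; ring
      _ ≤ 2 * (P : ℝ) ^ 4 := by linarith
  -- conclude
  have hP0' : (0 : ℝ) < (P : ℝ) := by exact_mod_cast hP0
  have hsplit : (P : ℝ) ^ (5 + e) = (P : ℝ) ^ 4 * (P : ℝ) ^ (1 + e) := by
    rw [show (5 + e) = (4 : ℝ) + (1 + e) by ring, Real.rpow_add hP0']
    congr 1
    rw [← Real.rpow_natCast]; norm_num
  have hcn : (0 : ℝ) ≤ ((a' + b' : ℕ) : ℝ) := by positivity
  have hgc : (c : ℝ) = (g : ℝ) * ((a' + b' : ℕ) : ℝ) := by rw [hc']; push_cast; ring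
  calc (c : ℝ) ^ 3 = ((g : ℝ) ^ 3 * ((a' + b' : ℕ) : ℝ) ^ 2) * ((a' + b' : ℕ) : ℝ) := by rw [hgc]; ring
    _ ≤ (2 * (P : ℝ) ^ 4) * ((a' + b' : ℕ) : ℝ) := mul_le_mul_of_nonneg_right hineq hcn
    _ < (2 * (P : ℝ) ^ 4) * (K * (P : ℝ) ^ (1 + e)) := by
        apply mul_lt_mul_of_pos_left hc'lt; positivity
    _ = 2 * K * (P : ℝ) ^ (5 + e) := by rw [hsplit]; ring

/-- `abc ≤ P⁴` for a level-4 tower point (`(xᵢyᵢzᵢ)^{i+1} ≤ (xᵢyᵢzᵢ)⁴`). -/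
theorem abc_le_towerProd_pow_four (x y z : Fin 4 → ℕ) (hpos : ∀ i, 0 < x i ∧ 0 < y i ∧ 0 < z i) :
    (∏ i, x i ^ (i.val + 1)) * (∏ i, y i ^ (i.val + 1)) * (∏ i, z i ^ (i.val + 1)) ≤
      (∏ i, x i * y i * z i) ^ 4 := by
  have hprod : (∏ i, x i ^ (i.val + 1)) * (∏ i, y i ^ (i.val + 1)) * (∏ i, z i ^ (i.val + 1)) =
      ∏ i, (x i * y i * z i) ^ (i.val + 1) := by
    rw [← Finset.prod_mul_distrib, ← Finset.prod_mul_distrib]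
    refine Finset.prod_congr rfl fun i _ => ?_
    ring
  rw [hprod, ← Finset.prod_pow]
  apply Finset.prod_le_prod (fun i _ => by positivity) fun i _ => ?_
  apply Nat.pow_le_pow_right
  · exact Nat.mul_pos (Nat.mul_pos (hpos i).1 (hpos i).2.1) (hpos i).2.2
  · have := i.isLt; omega

/-- **Coprimality is not load-bearing (conditionally).** `ABC ⟹ TowerIneq4NoCoprime A` for every
`A > 5/3` (the inequality WITHOUT the coprimality hypothesis, inlined): with `K = C_abc(3A − 5)`, `cube_lt_of_abc` gives `c³ < 2K·Π^{3A}`, and `(K+1)³ ≥ 2K`,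
`Π ≥ 1` give `c < (K+1)·Π^{A+ε}`.  Together with `Negative.DialCalibration.towerIneq4NoCoprime_false_below_four_thirds`:
under `ABC` the non-coprime dial lies in `[4/3, 5/3]`, the coprime one is exactly `1`; the crux's
threshold `2` is above both, so nothing forces a proof of the crux to use coprimality. -/
theorem towerIneq4NoCoprime_of_abc (habc : ABC) (A : ℝ) (hA : 5 / 3 < A) :
    ∀ ε : ℝ, 0 < ε → ∃ C : ℝ, 0 < C ∧ ∀ x y z : Fin 4 → ℕ, (∀ i, 0 < x i ∧ 0 < y i ∧ 0 < z i) →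
      (∏ i, x i ^ (i.val + 1)) + (∏ i, y i ^ (i.val + 1)) = ∏ i, z i ^ (i.val + 1) →
      ((∏ i, z i ^ (i.val + 1) : ℕ) : ℝ) < C * ((∏ i, x i * y i * z i : ℕ) : ℝ) ^ (A + ε) := by
  intro ε hε
  obtain ⟨K, hK, hK'⟩ := (ABC_iff.mp habc) (3 * A - 5) (by linarith)
  refine ⟨K + 1, by linarith, fun x y z hpos heq => ?_⟩
  have ha : 0 < ∏ i, x i ^ (i.val + 1) := Finset.prod_pos fun i _ => pow_pos (hpos i).1 _
  have hb : 0 < ∏ i, y i ^ (i.val + 1) := Finset.prod_pos fun i _ => pow_pos (hpos i).2.1 _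
  have hP0 : 0 < ∏ i, x i * y i * z i :=
    Finset.prod_pos fun i _ => Nat.mul_pos (Nat.mul_pos (hpos i).1 (hpos i).2.1) (hpos i).2.2
  have hcube := cube_lt_of_abc (e := 3 * A - 5) (by linarith) hK' ha hb heq hP0
    (abc_le_towerProd_pow_four x y z hpos) (by have := rad_dvd_towerProd x y z; rwa [rad_def] at this)
  have hP1 : (1 : ℝ) ≤ ((∏ i, x i * y i * z i : ℕ) : ℝ) := by exact_mod_cast hP0
  set P : ℝ := ((∏ i, x i * y i * z i : ℕ) : ℝ) with hPdef
  refine lt_of_pow_lt_pow_left₀ 3 (by positivity) ?_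
  calc ((∏ i, z i ^ (i.val + 1) : ℕ) : ℝ) ^ 3 < 2 * K * P ^ (5 + (3 * A - 5)) := hcube
    _ ≤ (K + 1) ^ 3 * P ^ (3 * (A + ε)) := by
        have h1 : 2 * K ≤ (K + 1) ^ 3 := by
          nlinarith [sq_nonneg K, mul_nonneg (mul_nonneg hK.le hK.le) hK.le]
        have h2 : P ^ (5 + (3 * A - 5)) ≤ P ^ (3 * (A + ε)) :=
          Real.rpow_le_rpow_of_exponent_le hP1 (by linarith)
        have h3 : (0 : ℝ) ≤ P ^ (5 + (3 * A - 5)) := Real.rpow_nonneg (by linarith) _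
        calc 2 * K * P ^ (5 + (3 * A - 5)) ≤ (K + 1) ^ 3 * P ^ (5 + (3 * A - 5)) :=
              mul_le_mul_of_nonneg_right h1 h3
          _ ≤ (K + 1) ^ 3 * P ^ (3 * (A + ε)) := mul_le_mul_of_nonneg_left h2 (by positivity)
    _ = ((K + 1) * P ^ (A + ε)) ^ 3 := by
        rw [mul_pow, show (3 : ℝ) * (A + ε) = (A + ε) * 3 by ring, Real.rpow_mul (by linarith),
          show ((P ^ (A + ε)) ^ (3 : ℝ)) = (P ^ (A + ε)) ^ (3 : ℕ) by rw [← Real.rpow_natCast]; norm_num]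

/-- The exact slack identity of the Liouville bound: `Π⁴ = abc · E` with the *excess*
`E = (x₀y₀z₀)³ (x₁y₁z₁)² (x₂y₂z₂)` (indices `0,1,2` = exponents `1,2,3`). -/
theorem towerProd_pow_four_eq (x y z : Fin 4 → ℕ) :
    (∏ i, x i * y i * z i) ^ 4 =
      (∏ i, x i ^ (i.val + 1)) * (∏ i, y i ^ (i.val + 1)) * (∏ i, z i ^ (i.val + 1)) *
        ((x 0 * y 0 * z 0) ^ 3 * (x 1 * y 1 * z 1) ^ 2 * (x 2 * y 2 * z 2)) := by
  simp only [Fin.prod_univ_four, Fin.isValue, Fin.val_zero, Fin.val_one, Fin.val_two]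
  simp only [show (3 : Fin 4).val = 3 from rfl]
  ring

/-- **Shape of a bad point (dictionary to the Thue regime).** If a positive tower point `a + b = c`
satisfies `C · Π^s ≤ c` (it violates the tower inequality with exponent `s` and constant `C`), then
`min(a,b) · E · c² ≤ 2 · (c/C)^{4/s}`, where `E = (x₀y₀z₀)³(x₁y₁z₁)²(x₂y₂z₂)`.  For `s = 2 − δ` the
right side is `2 C^{-4/s} · c^{2 + 2δ/(2−δ)}`: so `min(a,b) · E ≤ 2C^{-4/s} c^{2δ/(2−δ)}` — the smaller
summand AND every non-quartic coordinate are `c^{O(δ)}`, i.e. the point is `a + vY⁴ = wZ⁴` with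
`a·v·w ≤ a·E = c^{O(δ)}` (`v = y₀y₁²y₂³ ≤ E`, `w = z₀z₁²z₂³ ≤ E`). Proof: `Π⁴ = abcE`, `max(a,b) ≥ c/2`. -/
theorem bad_point_shape {C s : ℝ} (hC : 0 < C) (hs : 0 < s) (x y z : Fin 4 → ℕ)
    (hpos : ∀ i, 0 < x i ∧ 0 < y i ∧ 0 < z i)
    (heq : (∏ i, x i ^ (i.val + 1)) + (∏ i, y i ^ (i.val + 1)) = ∏ i, z i ^ (i.val + 1))
    (hbad : C * ((∏ i, x i * y i * z i : ℕ) : ℝ) ^ s ≤ ((∏ i, z i ^ (i.val + 1) : ℕ) : ℝ)) :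
    ((min (∏ i, x i ^ (i.val + 1)) (∏ i, y i ^ (i.val + 1)) : ℕ) : ℝ) *
        (((x 0 * y 0 * z 0) ^ 3 * (x 1 * y 1 * z 1) ^ 2 * (x 2 * y 2 * z 2) : ℕ) : ℝ) *
        ((∏ i, z i ^ (i.val + 1) : ℕ) : ℝ) ^ 2 ≤
      2 * (((∏ i, z i ^ (i.val + 1) : ℕ) : ℝ) / C) ^ (4 / s) := by
  -- abbreviations
  generalize ha : (∏ i, x i ^ (i.val + 1)) = a at heq ⊢
  generalize hb : (∏ i, y i ^ (i.val + 1)) = b at heq ⊢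
  generalize hc : (∏ i, z i ^ (i.val + 1)) = c at heq hbad ⊢
  generalize hE : ((x 0 * y 0 * z 0) ^ 3 * (x 1 * y 1 * z 1) ^ 2 * (x 2 * y 2 * z 2)) = E
  have hP4 : (∏ i, x i * y i * z i) ^ 4 = a * b * c * E := by
    rw [towerProd_pow_four_eq, ha, hb, hc, hE]
  generalize hP : (∏ i, x i * y i * z i) = P at hP4 hbad
  have hP0 : 0 < P := by
    rw [← hP]; exact Finset.prod_pos fun i _ => Nat.mul_pos (Nat.mul_pos (hpos i).1 (hpos i).2.1) (hpos i).2.2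
  -- real version of Π⁴ ≤ (c/C)^{4/s}
  have hPR : (0 : ℝ) < P := by exact_mod_cast hP0
  have hcC : (P : ℝ) ^ s ≤ (c : ℝ) / C := by
    rw [le_div_iff₀ hC]; linarith
  have hPle : (P : ℝ) ≤ ((c : ℝ) / C) ^ (1 / s) := by
    have : ((P : ℝ) ^ s) ^ (1 / s) ≤ ((c : ℝ) / C) ^ (1 / s) :=
      Real.rpow_le_rpow (by positivity) hcC (by positivity)
    rwa [← Real.rpow_mul hPR.le, mul_one_div_cancel hs.ne', Real.rpow_one] at this
  have hcC0 : (0 : ℝ) ≤ (c : ℝ) / C := le_trans (by positivity) hcC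
  have hP4le : (P : ℝ) ^ 4 ≤ ((c : ℝ) / C) ^ (4 / s) := by
    calc (P : ℝ) ^ 4 ≤ (((c : ℝ) / C) ^ (1 / s)) ^ 4 := by gcongr
      _ = ((c : ℝ) / C) ^ (4 / s) := by
          rw [← Real.rpow_natCast, ← Real.rpow_mul hcC0]; norm_num; ring_nf
  -- combinatorial part: min(a,b) · E · c² ≤ 2 · a b c E = 2 P⁴
  have hP4R : ((P : ℝ)) ^ 4 = (a : ℝ) * b * c * E := by exact_mod_cast hP4
  have hkey : ((min a b : ℕ) : ℝ) * (E : ℝ) * (c : ℝ) ^ 2 ≤ 2 * ((a : ℝ) * b * c * E) := by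
    have hE0 : (0 : ℝ) ≤ (E : ℝ) := by positivity
    have hc0 : (0 : ℝ) ≤ (c : ℝ) := by positivity
    rcases le_total a b with hab | hab
    · rw [min_eq_left hab]
      have h2b : (c : ℝ) ≤ 2 * (b : ℝ) := by
        have : c ≤ 2 * b := by omega
        exact_mod_cast this
      have ha0 : (0 : ℝ) ≤ (a : ℝ) := by positivity
      calc (a : ℝ) * E * (c : ℝ) ^ 2 = ((a : ℝ) * E * c) * c := by ring
        _ ≤ ((a : ℝ) * E * c) * (2 * b) := mul_le_mul_of_nonneg_left h2b (by positivity)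
        _ = 2 * ((a : ℝ) * b * c * E) := by ring
    · rw [min_eq_right hab]
      have h2a : (c : ℝ) ≤ 2 * (a : ℝ) := by
        have : c ≤ 2 * a := by omega
        exact_mod_cast this
      calc (b : ℝ) * E * (c : ℝ) ^ 2 = ((b : ℝ) * E * c) * c := by ring
        _ ≤ ((b : ℝ) * E * c) * (2 * a) := mul_le_mul_of_nonneg_left h2a (by positivity)
        _ = 2 * ((a : ℝ) * b * c * E) := by ring
  calc ((min a b : ℕ) : ℝ) * (E : ℝ) * (c : ℝ) ^ 2 ≤ 2 * ((a : ℝ) * b * c * E) := hkey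
    _ = 2 * (P : ℝ) ^ 4 := by rw [hP4R]
    _ ≤ 2 * ((c : ℝ) / C) ^ (4 / s) := by linarith

end Summit.ABC.ABC.Theorems.TowerFourSubLiouville.Negative
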